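import Literature.MathematicalPhysics.QuantumLattice.FockRelabel
import Literature.MathematicalPhysics.QuantumLattice.SpinTwistedHubbardTorus

/-!
# Rotation covariance of the spin-twisted Hubbard torus (crux `NodalDiracWeakCoupling`, line `birth`)

Route `HubbardSuperconductivity/NodalDiracTwist`, crux stmt-HubbardSuperconductivity-10370, skeleton
`Cruxes/NodalDiracWeakCoupling/Lines/birth.lean`, stub `stub_rotCovariance`.

The spin-twisted Hubbard torus in the boost gauge,
`H_L(U, φ) = -Σ_{x,μ,σ} (e^{i(-1)^σ φ_μ/L} c†_{xσ} c_{x+e_μ,σ} + h.c.) + U Σ_x n_{x↑} n_{x↓}`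
(`spinTwistedHubbardTorus L U φ`), is covariant under the rotation by `π/2` of the square torus
`(ℤ/Lℤ)²`, `r (x₀, x₁) = (-x₁, x₀)` (the `D₄` generator `DihedralGroup.r 1`, site map `rotSite`),
second-quantised as the Bogoliubov automorphism `Γ_r = relabel (Orb.d4Perm r)`
(`Γ_r c_{xσ} Γ_r⁻¹ = c_{r x, σ}`):

  `Γ_r H_L(U, (φ₀, φ₁)) Γ_r⁻¹ = H_L(U, (-φ₁, φ₀))` (`stub_rotCovariance`).

Proof: the on-site interaction `Σ_x n_{x↑} n_{x↓}` is reindexed by `r`; in the hopping term the bond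
`(x, x + e₀)` goes to `(r x, r x + e₁)` (`rotSite_add_single_zero`), so the `μ = 0` terms become the
`μ = 1` terms with the same phase (`φ'₁ = φ₀`), while the bond `(x, x + e₁)` goes to
`(r x, r x - e₀)` (`rotSite_add_single_one`); after reindexing `y = r x - e₀` this is the reversed
`e₀`-bond `(y + e₀, y)`, which in `spinTwistedHopping` carries the conjugate phase (`φ'₀ = -φ₁`).

## References

S. Karakuzu, K. Seki, S. Sorella, PRB 98 (2018) 075156, Sec. II D (spin-twisted boundary
conditions and the lattice symmetries); D. J. Scalapino, Phys. Rep. 250 (1995) 329, §2 (the point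
group of the square lattice). No new definitions, no named facts.
-/

-- the mandated namespace repeats `HubbardSuperconductivity` (single-problem summit, D-0017)
set_option linter.dupNamespace false

noncomputable section

namespace Summit.HubbardSuperconductivity.HubbardSuperconductivity.Theorems.NodalDiracTwist

open Literature.MathematicalPhysics.QuantumLattice Literature.Probability.LatticeModels Matrix

section RotCovariance

variable (L : ℕ) [NeZero L]

/-- `(shiftEquiv μ)⁻¹ x = x - e_μ` (definitional). [folklore] -/
theorem fermionTorus_shiftEquiv_symm_apply {d : ℕ} (μ : Fin d) (x : FermionTorus d L) :
    (FermionTorus.shiftEquiv μ).symm x = FermionTorus.unshift x μ := rfl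

/-- **The rotation maps the `e₀`-bond `(x, x + e₀)` to the `e₁`-bond `(r x, r x + e₁)`**:
`r (x + e₀) = r x + e₁` on the fermionic torus. Scalapino, Phys. Rep. 250 (1995) 329, §2. [folklore] -/
theorem ofTorusEquiv_rot_shift_zero (x : FermionTorus 2 L) :
    FermionTorus.ofTorusEquiv (d4SitePerm (DihedralGroup.r 1)) (FermionTorus.shift x 0) =
      FermionTorus.shift (FermionTorus.ofTorusEquiv (d4SitePerm (DihedralGroup.r 1)) x) 1 := by
  apply FermionTorus.toTorusSite_injective
  rw [FermionTorus.toTorusSite_shift, FermionTorus.toTorusSite_ofTorusEquiv,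
    FermionTorus.toTorusSite_ofTorusEquiv, FermionTorus.toTorusSite_shift, d4SitePerm_apply,
    d4SitePerm_apply]
  -- `d4Site (r 1) = rotSite` definitionally
  exact rotSite_add_single_zero (FermionTorus.toTorusSite x)

/-- **The rotation maps the `e₁`-bond `(x, x + e₁)` to the reversed `e₀`-bond `(r x, r x - e₀)`**:
`r (x + e₁) = r x - e₀` on the fermionic torus. Scalapino, Phys. Rep. 250 (1995) 329, §2. [folklore] -/
theorem ofTorusEquiv_rot_shift_one (x : FermionTorus 2 L) :
    FermionTorus.ofTorusEquiv (d4SitePerm (DihedralGroup.r 1)) (FermionTorus.shift x 1) =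
      FermionTorus.unshift (FermionTorus.ofTorusEquiv (d4SitePerm (DihedralGroup.r 1)) x) 0 := by
  apply FermionTorus.toTorusSite_injective
  rw [FermionTorus.toTorusSite_unshift, FermionTorus.toTorusSite_ofTorusEquiv,
    FermionTorus.toTorusSite_ofTorusEquiv, FermionTorus.toTorusSite_shift, d4SitePerm_apply,
    d4SitePerm_apply, eq_sub_iff_add_eq]
  -- `d4Site (r 1) = rotSite` definitionally
  exact rotSite_add_single_one (FermionTorus.toTorusSite x)

/-- **Rotation covariance of the spin-twisted hopping**: `Γ_r T_L(φ₀, φ₁) Γ_r⁻¹ = T_L(-φ₁, φ₀)`.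
The `e₀`-bonds go to `e₁`-bonds with the same phase; the `e₁`-bonds go to reversed `e₀`-bonds,
i.e. to `e₀`-bonds with the conjugate phase. Karakuzu–Seki–Sorella, PRB 98 (2018) 075156,
Sec. II D; Scalapino, Phys. Rep. 250 (1995) 329, §2. [folklore] -/
theorem relabel_d4Perm_rot_spinTwistedHopping (φ : Fin 2 → ℝ) :
    relabel (Orb.d4Perm (L := L) (DihedralGroup.r 1)) (spinTwistedHopping L φ) =
      spinTwistedHopping L ![-φ 1, φ 0] := by
  rw [Orb.d4Perm_eq_mapEquiv]
  unfold spinTwistedHopping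
  conv_lhs => rw [Finset.sum_comm, Fin.sum_univ_two, relabel_add, relabel_sum, relabel_sum]
  conv_rhs => rw [Finset.sum_comm, Fin.sum_univ_two, add_comm]
  refine congrArg₂ (· + ·) ?_ ?_
  · -- the `e₀`-bonds `(x, x + e₀) ↦ (r x, r x + e₁)`: same phase, `φ'₁ = φ₀`
    refine Fintype.sum_equiv (FermionTorus.ofTorusEquiv (d4SitePerm (DihedralGroup.r 1))) _ _
      fun x => ?_
    simp only [relabel_sum, relabel_add, relabel_smul, relabel_mul, relabel_creation,
      relabel_annihilation, Orb.mapEquiv_orb, ofTorusEquiv_rot_shift_zero, Matrix.cons_val_one,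
      Matrix.cons_val_zero]
  · -- the `e₁`-bonds `(x, x + e₁) ↦ (r x, r x - e₀)`: reversed `e₀`-bonds, `φ'₀ = -φ₁`
    refine Fintype.sum_equiv ((FermionTorus.ofTorusEquiv (d4SitePerm (DihedralGroup.r 1))).trans
      (FermionTorus.shiftEquiv 0).symm) _ _ fun x => ?_
    simp only [Equiv.trans_apply, fermionTorus_shiftEquiv_symm_apply, FermionTorus.shift_unshift,
      relabel_sum, relabel_add, relabel_smul, relabel_mul, relabel_creation, relabel_annihilation,
      Orb.mapEquiv_orb, ofTorusEquiv_rot_shift_one, Matrix.cons_val_zero, mul_neg, neg_div,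
      Complex.ofReal_neg, neg_neg]
    exact Finset.sum_congr rfl fun σ _ => add_comm _ _

/-- **Rotation invariance of the on-site interaction**:
`Γ_r (Σ_x n_{x↑} n_{x↓}) Γ_r⁻¹ = Σ_x n_{x↑} n_{x↓}` (reindex the sites by `r`).
Scalapino, Phys. Rep. 250 (1995) 329, §2. [folklore] -/
theorem relabel_d4Perm_rot_interaction :
    relabel (Orb.d4Perm (L := L) (DihedralGroup.r 1))
        (∑ x : FermionTorus 2 L, numberOp x 0 * numberOp x 1) =
      ∑ x : FermionTorus 2 L, numberOp x 0 * numberOp x 1 := by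
  rw [Orb.d4Perm_eq_mapEquiv, relabel_sum]
  simp only [relabel_mul, relabel_mapEquiv_numberOp]
  exact Equiv.sum_comp (FermionTorus.ofTorusEquiv (d4SitePerm (DihedralGroup.r 1)))
    (fun x => numberOp x 0 * numberOp x 1)

end RotCovariance

/-- **Rotation covariance of the spin-twisted Hubbard torus** (stub `stub_rotCovariance` of line
`birth`): for the `D₄` generator `r = DihedralGroup.r 1` (site map `rotSite (x₀, x₁) = (-x₁, x₀)`,
second-quantised as the Bogoliubov automorphism `relabel (Orb.d4Perm r)`, `Γ c_{xσ} Γ⁻¹ = c_{r x, σ}`),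
`Γ_r H_L(U, (φ₀, φ₁)) Γ_r⁻¹ = H_L(U, (-φ₁, φ₀))`: the interaction is reindexed by `r`, the
`e₀`-bonds of the hopping become `e₁`-bonds with the same phase and the `e₁`-bonds become reversed
`e₀`-bonds (conjugate phase). Karakuzu–Seki–Sorella, PRB 98 (2018) 075156, Sec. II D; Scalapino,
Phys. Rep. 250 (1995) 329, §2. [folklore] -/
theorem stub_rotCovariance (L : ℕ) [NeZero L] (U : ℝ) (φ : Fin 2 → ℝ) :
    relabel (Orb.d4Perm (L := L) (DihedralGroup.r 1)) (spinTwistedHubbardTorus L U φ) =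
      spinTwistedHubbardTorus L U ![-φ 1, φ 0] := by
  rw [spinTwistedHubbardTorus, spinTwistedHubbardTorus, neg_add_eq_sub, neg_add_eq_sub,
    relabel_sub, relabel_smul, relabel_d4Perm_rot_spinTwistedHopping,
    relabel_d4Perm_rot_interaction]

end Summit.HubbardSuperconductivity.HubbardSuperconductivity.Theorems.NodalDiracTwist

end
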